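import Literature.MathematicalPhysics.QuantumLattice.SchwingerOSCluster
import Literature.MathematicalPhysics.QuantumLattice.OSAxiomsMeasureProofs
import Literature.Analysis.FunctionSpaces.SchwartzParametric
import Mathlib.Analysis.InnerProductSpace.Completion
import Mathlib.Analysis.Normed.Module.Completion
import Mathlib.Analysis.Normed.Operator.Extend
import HarnessLib

/-!
# The Osterwalder–Schrader Hilbert space of a reflection-positive Schwinger family

Osterwalder–Schrader I (CMP 31 (1973)), §4.1, eqs. (4.3)–(4.4): for a Schwinger family
`𝔖 = (𝔖ₙ)` satisfying reflection positivity E2, the sesquilinear form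
`(f, g) = ∑ₙₘ 𝔖ₙ₊ₘ(Θfₙ* ⊗ gₘ)` on finite sequences `f = (f₀, f₁, …)` of positive-time test
functions `fₙ ∈ 𝒮₊((ℝ^d)^n)` is positive semidefinite, and the physical Hilbert space `ℋ` is the
completion of the quotient by its null space; the vacuum is the class of the sequence
`(1, 0, 0, …)`.

This file carries out this construction for the tree's distributional OS axioms
(`SchwingerFamily.IsOSReflectionPositive`), on the free `ℂ`-module over the **generators**
`(n, F)`, `F` a positive-time `n`-point test function (redundant presentation: `δ_{F+G}` and
`δ_F + δ_G` differ by a null vector, which the completion identifies), exactly parallel to the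
Wightman-side GNS construction `Literature.Analysis.FunctionSpaces.WightmanGNS`:

* `genPairing 𝔖 p q = 𝔖.osPairing F G = 𝔖_{n+m}(ΘF* ⊗ G)` (the tree's `SchwingerFamily.osPairing`,
  `SchwingerOSPositivity`), the form `osFormFree` and its sesquilinear packaging
  `osFormL` (linearity of `⊗`, conjugate-linearity of `Θ·*` and the translation identities are the
  tree's `SchwartzMap.appendTensor_add_left` …, `osAdjoint_add/smul`, `translateMulti_appendTensor`,
  `translateMulti_translateMulti` of `SchwingerOSPositivity` / `SchwingerOSCluster`);
* positivity `osFormFree_self_nonneg` from E2 (regrouping a finite combination of generators by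
  degree, `degreeComponent`) and hermitian symmetry by polarisation
  (`conj_symm_of_im_apply_self`, `OSAxiomsMeasureProofs`);
* the `PreInnerProductSpace.Core` on the type synonym `OSSpace 𝔖 hE2`, the Hilbert space
  `OSHilbert 𝔖 hE2 := UniformSpace.Completion (OSSpace 𝔖 hE2)`, the dense embedding `ι` and the
  vacuum `Ω = [δ_{(0,1)}]` with `‖Ω‖ = 1` under `𝔖₀ = 1`;
* the **time-translation semigroup** `T(t)`, `t ≥ 0`, generatorwise (`shiftOp`): semigroup law,
  symmetry `⟪T(t) v, w⟫ = ⟪v, T(t) w⟫` from E1 (`Θ(F_t)* = (ΘF*)_{-t}` and joint translation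
  invariance, OS I (4.7)), polynomial growth of the orbits from the temperedness E0 of each `𝔖ₙ`
  (automatic for continuous functionals; the named fact `SchwingerFamily.exists_bound` is
  discharged here as `exists_bound_holds`)
  (`exists_norm_shiftOp_le`, through `SchwartzMap.seminorm_compSubConstCLM_le` of
  `SchwartzParametric`), and the **contraction property** `‖T(t) v‖ ≤ ‖v‖` (OS I (4.8)–(4.9),
  Glimm–Jaffe Thm. 6.1.3 (iii)) by the doubly exponential iteration
  (`Literature.MathematicalPhysics.QuantumFieldTheory.le_of_sq_le_mul_succ_of_le_mul_pow`, the growth version of the tree's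
  `le_of_sq_le_mul_succ`); hence the contraction semigroup `e^{-tH}` on the Hilbert space
  (`shiftH`, `LinearMap.extendOfNorm`): contraction, semigroup law, symmetry, `e^{-tH} Ω = Ω`.

Not here: strong continuity of `t ↦ e^{-tH}` and the spectral calculus (Mathlib has no spectral
theorem for unbounded self-adjoint operators), the field operators, and the analytic
continuation of OS II — the next steps towards `OS1975_exists_forwardTube_continuation`.

## References
* K. Osterwalder, R. Schrader, Axioms for Euclidean Green's functions, CMP 31 (1973), §4.1,
  eqs. (4.3)–(4.9); §4.4, p. 97 (the vacuum).
* J. Glimm, A. Jaffe, Quantum Physics (2nd ed. 1987), §6.1, Prop. 6.1.1, Thm. 6.1.3.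
-/

noncomputable section

open Filter Topology ComplexConjugate
open scoped InnerProductSpace SchwartzMap ComplexOrder

namespace Literature.MathematicalPhysics.QuantumFieldTheory

variable {d : ℕ} [NeZero d]

/-! ## Linearity of the tensor and conjugate-linearity of the OS adjoint -/

section TensorLinear

variable {n m : ℕ}

/-- `appendTensor 0 G = 0` (a deliberate `SchwartzMap` dot-notation extension next to the tree's
`SchwartzMap.appendTensor_add_left` etc.). [folklore] -/
@[simp] theorem _root_.SchwartzMap.appendTensor_zero_left {E : Type*} [NormedAddCommGroup E] [NormedSpace ℝ E]
    (G : 𝓢((Fin m → E), ℂ)) : SchwartzMap.appendTensor (0 : 𝓢((Fin n → E), ℂ)) G = 0 := by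
  ext x; simp [SchwartzMap.appendTensor_apply]

/-- `appendTensor F 0 = 0`. [folklore] -/
@[simp] theorem _root_.SchwartzMap.appendTensor_zero_right {E : Type*} [NormedAddCommGroup E] [NormedSpace ℝ E]
    (F : 𝓢((Fin n → E), ℂ)) : SchwartzMap.appendTensor F (0 : 𝓢((Fin m → E), ℂ)) = 0 := by
  ext x; simp [SchwartzMap.appendTensor_apply]

end TensorLinear

section SchwingerFamily
open Literature.MathematicalPhysics.QuantumLattice (SchwingerFamily)
open Literature.MathematicalPhysics.QuantumLattice.SchwingerFamily

variable (𝔖 : SchwingerFamily (EuclideanSpace ℝ (Fin d)))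

/-! ## Generators and the OS form on the free module -/

variable (d) in
/-- A **generator** of the OS pre-Hilbert space: a degree `n` and a positive-time `n`-point test
function `F ∈ 𝒮₊((ℝ^d)^n)` (Osterwalder–Schrader I (1973), §4.1, the sequences
`f ∈ 𝒮₊`). [cite: OsterwalderSchraderCMP1973, §4.1] -/
def _root_.Literature.MathematicalPhysics.QuantumLattice.SchwingerFamily.PosGen : Type :=
  Σ n : ℕ, {F : 𝓢((Fin n → EuclideanSpace ℝ (Fin d)), ℂ) // QuantumLattice.IsPositiveTimeMulti F}

/-- The **pairing of two generators**: the tree's OS pairing `SchwingerFamily.osPairing`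
(`SchwingerOSPositivity`), `𝔖_{n+m}(ΘF* ⊗ G)`, of the underlying test functions
(Osterwalder–Schrader I (1973), eq. (4.3), the summands). [cite: OsterwalderSchraderCMP1973, §4.1 eq. (4.3)] -/
def _root_.Literature.MathematicalPhysics.QuantumLattice.SchwingerFamily.genPairing (p q : PosGen d) : ℂ :=
  𝔖.osPairing p.2.1 q.2.1

/-- `genPairing` is `osPairing` of the underlying test functions (definitional). [folklore] -/
theorem _root_.Literature.MathematicalPhysics.QuantumLattice.SchwingerFamily.genPairing_eq (p q : PosGen d) : genPairing 𝔖 p q = 𝔖.osPairing p.2.1 q.2.1 := rfl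

/-- The **OS form** on the free `ℂ`-module over generators:
`(v, w) = ∑_{p,q} conj(v_p) w_q 𝔖(ΘF_p* ⊗ F_q)` (Osterwalder–Schrader I (1973), eq. (4.3)). [cite: OsterwalderSchraderCMP1973, §4.1 eq. (4.3)] -/
def _root_.Literature.MathematicalPhysics.QuantumLattice.SchwingerFamily.osFormFree (v w : PosGen d →₀ ℂ) : ℂ :=
  conj (Finsupp.linearCombination ℂ (fun p => conj (Finsupp.linearCombination ℂ (genPairing 𝔖 p) w)) v)

/-- The OS form as a double sum over the supports. [folklore] -/
theorem _root_.Literature.MathematicalPhysics.QuantumLattice.SchwingerFamily.osFormFree_eq_sum (v w : PosGen d →₀ ℂ) :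
    osFormFree 𝔖 v w = ∑ p ∈ v.support, ∑ q ∈ w.support, conj (v p) * w q * genPairing 𝔖 p q := by
  simp only [osFormFree, Finsupp.linearCombination_apply, Finsupp.sum, smul_eq_mul, map_sum,
    map_mul, Complex.conj_conj, Finset.mul_sum]
  refine Finset.sum_congr rfl fun p _ => Finset.sum_congr rfl fun q _ => ?_
  ring

/-- The OS form is additive in the first argument. [folklore] -/
theorem _root_.Literature.MathematicalPhysics.QuantumLattice.SchwingerFamily.osFormFree_add_left (x y z : PosGen d →₀ ℂ) :
    osFormFree 𝔖 (x + y) z = osFormFree 𝔖 x z + osFormFree 𝔖 y z := by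
  simp [osFormFree, map_add]

/-- The OS form is conjugate-homogeneous in the first argument. [folklore] -/
theorem _root_.Literature.MathematicalPhysics.QuantumLattice.SchwingerFamily.osFormFree_smul_left (x y : PosGen d →₀ ℂ) (r : ℂ) :
    osFormFree 𝔖 (r • x) y = conj r * osFormFree 𝔖 x y := by
  simp [osFormFree, map_smul]

/-- The OS form is additive in the second argument. [folklore] -/
theorem _root_.Literature.MathematicalPhysics.QuantumLattice.SchwingerFamily.osFormFree_add_right (x y z : PosGen d →₀ ℂ) :
    osFormFree 𝔖 x (y + z) = osFormFree 𝔖 x y + osFormFree 𝔖 x z := by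
  unfold osFormFree
  rw [← map_add]
  congr 1
  simp only [map_add, Finsupp.linearCombination_apply, Finsupp.sum, smul_eq_mul, mul_add,
    Finset.sum_add_distrib]

/-- The OS form is homogeneous in the second argument. [folklore] -/
theorem _root_.Literature.MathematicalPhysics.QuantumLattice.SchwingerFamily.osFormFree_smul_right (x y : PosGen d →₀ ℂ) (r : ℂ) :
    osFormFree 𝔖 x (r • y) = r * osFormFree 𝔖 x y := by
  unfold osFormFree
  simp only [map_smul, smul_eq_mul, map_mul, Finsupp.linearCombination_apply, Finsupp.sum,
    Finset.mul_sum, map_sum, Complex.conj_conj]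
  refine Finset.sum_congr rfl fun p _ => Finset.sum_congr rfl fun q _ => ?_
  ring

/-- The OS form as a sesquilinear map (conjugate-linear in the first argument). [folklore] -/
def _root_.Literature.MathematicalPhysics.QuantumLattice.SchwingerFamily.osFormL : (PosGen d →₀ ℂ) →ₗ⋆[ℂ] (PosGen d →₀ ℂ) →ₗ[ℂ] ℂ :=
  LinearMap.mk₂'ₛₗ (starRingEnd ℂ) (RingHom.id ℂ) (osFormFree 𝔖)
    (osFormFree_add_left 𝔖) (fun c x y => by rw [osFormFree_smul_left]; rfl)
    (osFormFree_add_right 𝔖) (fun c x y => by rw [osFormFree_smul_right]; rfl)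

/-- Unfolding of `osFormL`. [folklore] -/
@[simp] theorem _root_.Literature.MathematicalPhysics.QuantumLattice.SchwingerFamily.osFormL_apply (v w : PosGen d →₀ ℂ) : osFormL 𝔖 v w = osFormFree 𝔖 v w := rfl

/-! ## Positivity from E2 -/

/-- The **degree-`n` component** of a finite combination of generators:
`G n = ∑_{F of degree n} v_{(n,F)} F ∈ 𝒮((ℝ^d)^n)`. [folklore] -/
def _root_.Literature.MathematicalPhysics.QuantumLattice.SchwingerFamily.degreeComponent (v : PosGen d →₀ ℂ) (n : ℕ) : 𝓢((Fin n → EuclideanSpace ℝ (Fin d)), ℂ) :=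
  (v.split n).sum fun x c => c • x.1

/-- Degree components are positive-time. [folklore] -/
theorem _root_.Literature.MathematicalPhysics.QuantumLattice.SchwingerFamily.isPositiveTimeMulti_degreeComponent (v : PosGen d →₀ ℂ) (n : ℕ) :
    QuantumLattice.IsPositiveTimeMulti (degreeComponent v n) := by
  unfold degreeComponent Finsupp.sum
  exact (QuantumLattice.positiveTimeMultiSubmodule d n).sum_mem fun x _ =>
    (QuantumLattice.positiveTimeMultiSubmodule d n).smul_mem _ x.2

/-- Degree components vanish outside the degree support. [folklore] -/
theorem _root_.Literature.MathematicalPhysics.QuantumLattice.SchwingerFamily.degreeComponent_eq_zero {v : PosGen d →₀ ℂ} {n : ℕ} (hn : n ∉ v.splitSupport) :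
    degreeComponent v n = 0 := by
  rw [Finsupp.mem_splitSupport_iff_nonzero, not_not] at hn
  simp [degreeComponent, hn]

/-- **Regrouping by degree**: the OS form of `v` with itself is the E2 double sum of its degree
components, `(v, v) = ∑ₙₘ 𝔖ₙ₊ₘ(ΘGₙ* ⊗ Gₘ)`. [folklore] -/
theorem _root_.Literature.MathematicalPhysics.QuantumLattice.SchwingerFamily.osFormFree_self_eq_sum_degreeComponent (v : PosGen d →₀ ℂ) :
    osFormFree 𝔖 v v = ∑ n ∈ v.splitSupport, ∑ m ∈ v.splitSupport,
      𝔖 (n + m) (SchwartzMap.appendTensor (QuantumLattice.osAdjoint (degreeComponent v n)) (degreeComponent v m)) := by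
  classical
  -- expand the right-hand side by sesquilinearity
  have hexp : ∀ n m, 𝔖 (n + m) (SchwartzMap.appendTensor (QuantumLattice.osAdjoint (degreeComponent v n))
      (degreeComponent v m)) = (v.split n).sum fun x c => (v.split m).sum fun y c' =>
        conj c * c' * 𝔖.osPairing x.1 y.1 := by
    intro n m
    change 𝔖.osPairing (degreeComponent v n) (degreeComponent v m) =
      (v.split n).sum fun x c => (v.split m).sum fun y c' => conj c * c' * 𝔖.osPairing x.1 y.1
    simp only [degreeComponent, Finsupp.sum]
    exact 𝔖.osPairing_sum_smul _ _ _ _ _ _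
  simp only [hexp]
  rw [osFormFree, Finsupp.linearCombination_apply]
  erw [Finsupp.sigma_sum]
  simp only [Finsupp.sum, map_sum]
  refine Finset.sum_congr rfl fun n _ => ?_
  rw [Finset.sum_comm]
  refine Finset.sum_congr rfl fun x _ => ?_
  simp only [Finsupp.split_apply, smul_eq_mul, map_mul, Complex.conj_conj]
  rw [Finsupp.linearCombination_apply]
  erw [Finsupp.sigma_sum]
  simp only [Finsupp.sum, Finset.mul_sum]
  refine Finset.sum_congr rfl fun m _ => Finset.sum_congr rfl fun y _ => ?_
  simp only [Finsupp.split_apply, smul_eq_mul, genPairing]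
  ring

/-- **Positivity of the OS form from E2**: `0 ≤ (v, v)` (real and nonnegative) for every finite
combination `v` of positive-time generators (Osterwalder–Schrader I (1973), (4.3)). [cite: OsterwalderSchraderCMP1973, §4.1 eq. (4.3)] -/
theorem _root_.Literature.MathematicalPhysics.QuantumLattice.SchwingerFamily.osFormFree_self_nonneg (hE2 : 𝔖.IsOSReflectionPositive) (v : PosGen d →₀ ℂ) :
    0 ≤ (osFormFree 𝔖 v v).re ∧ (osFormFree 𝔖 v v).im = 0 := by
  classical
  set N : ℕ := v.splitSupport.sup id
  have hN : ∀ n, N < n → degreeComponent v n = 0 := fun n hn =>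
    degreeComponent_eq_zero fun h => (not_lt.2 (Finset.le_sup (f := id) h)) hn
  have h := hE2 N (degreeComponent v) hN (isPositiveTimeMulti_degreeComponent v)
    (fun n m => SchwartzMap.appendTensor (QuantumLattice.osAdjoint (degreeComponent v n)) (degreeComponent v m))
    (fun n m => QuantumLattice.isAppendTensorOf_appendTensor _ _)
  simp only at h
  have hsub : v.splitSupport ⊆ Finset.range (N + 1) := fun n hn =>
    Finset.mem_range.2 (Nat.lt_succ_of_le (Finset.le_sup (f := id) hn))
  have hvanish : ∀ n ∈ Finset.range (N + 1), n ∉ v.splitSupport → ∀ m,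
      𝔖 (n + m) (SchwartzMap.appendTensor (QuantumLattice.osAdjoint (degreeComponent v n)) (degreeComponent v m)) = 0 ∧
      𝔖 (m + n) (SchwartzMap.appendTensor (QuantumLattice.osAdjoint (degreeComponent v m)) (degreeComponent v n)) = 0 := by
    intro n _ hn m
    rw [degreeComponent_eq_zero hn]
    have h0 : QuantumLattice.osAdjoint (0 : 𝓢((Fin n → EuclideanSpace ℝ (Fin d)), ℂ)) = 0 := by
      ext x; simp [QuantumLattice.osAdjoint_apply]
    simp [h0]
  have heq : osFormFree 𝔖 v v = ∑ n ∈ Finset.range (N + 1), ∑ m ∈ Finset.range (N + 1),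
      𝔖 (n + m) (SchwartzMap.appendTensor (QuantumLattice.osAdjoint (degreeComponent v n)) (degreeComponent v m)) := by
    rw [osFormFree_self_eq_sum_degreeComponent]
    rw [Finset.sum_subset hsub (fun n hn hn' => Finset.sum_eq_zero fun m _ => (hvanish n hn hn' m).1)]
    refine Finset.sum_congr rfl fun n _ => ?_
    exact Finset.sum_subset hsub (fun m hm hm' => (hvanish m hm hm' n).2)
  rw [heq]
  exact h

/-- **Hermitian symmetry of the OS form** by polarisation from the reality of `(v, v)` (E2). [folklore] -/
theorem _root_.Literature.MathematicalPhysics.QuantumLattice.SchwingerFamily.conj_osFormFree (hE2 : 𝔖.IsOSReflectionPositive) (v w : PosGen d →₀ ℂ) :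
    conj (osFormFree 𝔖 w v) = osFormFree 𝔖 v w := by
  have := QuantumLattice.conj_symm_of_im_apply_self (osFormL 𝔖) (fun u => (osFormFree_self_nonneg 𝔖 hE2 u).2) v w
  simpa using this

/-! ## The pre-Hilbert space and the Hilbert space -/

/-- The **OS pre-Hilbert space**: the free `ℂ`-module over positive-time generators, to be
equipped with the OS form (type synonym; `hE2` is a parameter since the inner product is positive
by E2 and hermitian by polarisation) (Osterwalder–Schrader I (1973), §4.1). [cite: OsterwalderSchraderCMP1973, §4.1] -/
@[nolint unusedArguments]
def _root_.Literature.MathematicalPhysics.QuantumLattice.SchwingerFamily.OSSpace (𝔖 : SchwingerFamily (EuclideanSpace ℝ (Fin d))) (_hE2 : 𝔖.IsOSReflectionPositive) : Type :=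
  PosGen d →₀ ℂ

section OSSpace
open Literature.MathematicalPhysics.QuantumLattice.SchwingerFamily (OSSpace)

variable {𝔖} {hE2 : 𝔖.IsOSReflectionPositive}

/-- The free module structure (group). [folklore] -/
instance : AddCommGroup (OSSpace 𝔖 hE2) := inferInstanceAs (AddCommGroup (PosGen d →₀ ℂ))

/-- The free module structure (`ℂ`-module). [folklore] -/
instance : Module ℂ (OSSpace 𝔖 hE2) := inferInstanceAs (Module ℂ (PosGen d →₀ ℂ))

variable (𝔖 hE2) in
/-- The identification of the free module over generators with `OSSpace`. [folklore] -/
def _root_.Literature.MathematicalPhysics.QuantumLattice.SchwingerFamily.OSSpace.of : (PosGen d →₀ ℂ) ≃ₗ[ℂ] OSSpace 𝔖 hE2 := LinearEquiv.refl ℂ _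

variable (𝔖 hE2) in
/-- The basis vector `δ_{(n,F)}` of a generator. [folklore] -/
def _root_.Literature.MathematicalPhysics.QuantumLattice.SchwingerFamily.OSSpace.δ (p : PosGen d) : OSSpace 𝔖 hE2 := OSSpace.of 𝔖 hE2 (Finsupp.single p 1)

/-- The OS form as a `PreInnerProductSpace.Core` (Osterwalder–Schrader I (1973), (4.3):
"defines a positive semidefinite inner product"). [cite: OsterwalderSchraderCMP1973, §4.1 eq. (4.3)] -/
instance _root_.Literature.MathematicalPhysics.QuantumLattice.SchwingerFamily.OSSpace.instCore : PreInnerProductSpace.Core ℂ (OSSpace 𝔖 hE2) where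
  inner v w := osFormFree 𝔖 ((OSSpace.of 𝔖 hE2).symm v) ((OSSpace.of 𝔖 hE2).symm w)
  conj_inner_symm x y := conj_osFormFree 𝔖 hE2 _ _
  re_inner_nonneg x := (osFormFree_self_nonneg 𝔖 hE2 _).1
  add_left x y z := by simp only [map_add, osFormFree_add_left]
  smul_left x y r := by simp only [map_smul, osFormFree_smul_left]

/-- The seminormed group structure `‖v‖ = √(v, v)`. [folklore] -/
instance _root_.Literature.MathematicalPhysics.QuantumLattice.SchwingerFamily.OSSpace.instSeminormedAddCommGroup : SeminormedAddCommGroup (OSSpace 𝔖 hE2) :=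
  @InnerProductSpace.Core.toSeminormedAddCommGroup ℂ _ _ _ _ OSSpace.instCore

/-- The (semi-)inner product space structure. [folklore] -/
instance _root_.Literature.MathematicalPhysics.QuantumLattice.SchwingerFamily.OSSpace.instInnerProductSpace : InnerProductSpace ℂ (OSSpace 𝔖 hE2) :=
  InnerProductSpace.ofCore OSSpace.instCore

/-- The inner product is the OS form. [folklore] -/
theorem _root_.Literature.MathematicalPhysics.QuantumLattice.SchwingerFamily.OSSpace.inner_def (v w : OSSpace 𝔖 hE2) :
    ⟪v, w⟫_ℂ = osFormFree 𝔖 ((OSSpace.of 𝔖 hE2).symm v) ((OSSpace.of 𝔖 hE2).symm w) := rfl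

/-- `⟪δ_p, δ_q⟫ = 𝔖(ΘF_p* ⊗ F_q)`. [folklore] -/
@[simp] theorem _root_.Literature.MathematicalPhysics.QuantumLattice.SchwingerFamily.OSSpace.inner_δ_δ (p q : PosGen d) : ⟪OSSpace.δ 𝔖 hE2 p, OSSpace.δ 𝔖 hE2 q⟫_ℂ = genPairing 𝔖 p q := by
  rw [OSSpace.inner_def]
  change osFormFree 𝔖 (Finsupp.single p 1) (Finsupp.single q 1) = _
  simp [osFormFree]

/-- Every vector of `OSSpace` comes from the free module. [folklore] -/
theorem _root_.Literature.MathematicalPhysics.QuantumLattice.SchwingerFamily.OSSpace.of_symm_eq (v : OSSpace 𝔖 hE2) : OSSpace.of 𝔖 hE2 ((OSSpace.of 𝔖 hE2).symm v) = v :=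
  LinearEquiv.apply_symm_apply _ _

end OSSpace

/-- The **OS Hilbert space** `ℋ`: the completion of `OSSpace` (the completion of a seminormed
space identifies the null vectors, so this is the completion of `OSSpace / 𝒩` of
Osterwalder–Schrader I (1973), §4.1). [cite: OsterwalderSchraderCMP1973, §4.1] -/
abbrev _root_.Literature.MathematicalPhysics.QuantumLattice.SchwingerFamily.OSHilbert (hE2 : 𝔖.IsOSReflectionPositive) : Type := UniformSpace.Completion (OSSpace 𝔖 hE2)

section OSSpace
open Literature.MathematicalPhysics.QuantumLattice.SchwingerFamily (OSSpace)
open Literature.MathematicalPhysics.QuantumLattice.SchwingerFamily.OSSpace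

variable {𝔖} {hE2 : 𝔖.IsOSReflectionPositive}

variable (𝔖 hE2) in
/-- The canonical isometric linear map `OSSpace → OSHilbert`. [folklore] -/
def _root_.Literature.MathematicalPhysics.QuantumLattice.SchwingerFamily.OSSpace.ι : OSSpace 𝔖 hE2 →ₗᵢ[ℂ] OSHilbert 𝔖 hE2 := UniformSpace.Completion.toComplₗᵢ

/-- `ι` has dense range. [folklore] -/
theorem _root_.Literature.MathematicalPhysics.QuantumLattice.SchwingerFamily.OSSpace.denseRange_ι : DenseRange (ι 𝔖 hE2) := by
  rw [show (ι 𝔖 hE2 : OSSpace 𝔖 hE2 → OSHilbert 𝔖 hE2) = ((↑) : _ → _) from rfl]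
  exact UniformSpace.Completion.denseRange_coe

/-- `ι` preserves inner products. [folklore] -/
@[simp] theorem _root_.Literature.MathematicalPhysics.QuantumLattice.SchwingerFamily.OSSpace.inner_ι_ι (v w : OSSpace 𝔖 hE2) : ⟪ι 𝔖 hE2 v, ι 𝔖 hE2 w⟫_ℂ = ⟪v, w⟫_ℂ :=
  (ι 𝔖 hE2).inner_map_map v w

/-- `ι` preserves the (semi)norm. [folklore] -/
@[simp] theorem _root_.Literature.MathematicalPhysics.QuantumLattice.SchwingerFamily.OSSpace.norm_ι (v : OSSpace 𝔖 hE2) : ‖ι 𝔖 hE2 v‖ = ‖v‖ := (ι 𝔖 hE2).norm_map v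

/-! ### The vacuum -/

/-- The empty test function `1 ∈ 𝒮((ℝ^d)^0) ≅ ℂ` is positive-time (vacuously). [folklore] -/
theorem _root_.Literature.MathematicalPhysics.QuantumLattice.SchwingerFamily.OSSpace.isPositiveTimeMulti_const :
    QuantumLattice.IsPositiveTimeMulti (SchwartzMap.constOfSubsingleton (D := Fin 0 → EuclideanSpace ℝ (Fin d)) (1 : ℂ)) :=
  fun _ _ i => i.elim0

variable (d) in
/-- The vacuum generator `(0, 1)`. [folklore] -/
def _root_.Literature.MathematicalPhysics.QuantumLattice.SchwingerFamily.OSSpace.vacGen : PosGen d := ⟨0, ⟨SchwartzMap.constOfSubsingleton 1, isPositiveTimeMulti_const⟩⟩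

variable (𝔖 hE2) in
/-- The **vacuum** `Ω = [δ_{(0,1)}] = v((1, 0, 0, …))` (Osterwalder–Schrader I (1973), §4.4, p. 97,
after (4.29)). [cite: OsterwalderSchraderCMP1973, §4.4, p. 97] -/
def _root_.Literature.MathematicalPhysics.QuantumLattice.SchwingerFamily.OSSpace.vacuum : OSHilbert 𝔖 hE2 := ι 𝔖 hE2 (δ 𝔖 hE2 (vacGen d))

/-- `‖Ω‖ = 1` under the normalisation `𝔖₀ = 1`. [folklore] -/
theorem _root_.Literature.MathematicalPhysics.QuantumLattice.SchwingerFamily.OSSpace.norm_vacuum (h0 : 𝔖.IsNormalized) : ‖vacuum 𝔖 hE2‖ = 1 := by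
  have h : ⟪vacuum 𝔖 hE2, vacuum 𝔖 hE2⟫_ℂ = 1 := by
    rw [vacuum, inner_ι_ι, inner_δ_δ, genPairing]
    change 𝔖 0 (SchwartzMap.appendTensor (QuantumLattice.osAdjoint (vacGen d).2.1) (vacGen d).2.1) = 1
    rw [h0]
    erw [SchwartzMap.appendTensor_apply, QuantumLattice.osAdjoint_apply]
    simp only [vacGen]
    erw [SchwartzMap.constOfSubsingleton_apply (D := Fin 0 → EuclideanSpace ℝ (Fin d)) (1 : ℂ)]
    simp
  have h' : ‖vacuum 𝔖 hE2‖ ^ 2 = 1 := by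
    rw [← inner_self_eq_norm_sq (𝕜 := ℂ), h]
    simp
  exact (pow_eq_one_iff_of_nonneg (norm_nonneg _) two_ne_zero).1 h'

end OSSpace

/-! ## The time-translation semigroup on the pre-Hilbert space -/

/-- The time unit vector `e₀ = (1, 0, …, 0)` scaled by `t`. [folklore] -/
abbrev _root_.Literature.MathematicalPhysics.QuantumLattice.SchwingerFamily.timeVec (t : ℝ) : EuclideanSpace ℝ (Fin d) := EuclideanSpace.single 0 t

/-- `timeVec` is additive. [folklore] -/
theorem _root_.Literature.MathematicalPhysics.QuantumLattice.SchwingerFamily.timeVec_add (s t : ℝ) : timeVec (d := d) (s + t) = timeVec s + timeVec t := by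
  ext i
  simp only [timeVec, PiLp.add_apply, PiLp.single_apply]
  split_ifs <;> simp

/-- `timeVec 0 = 0`. [folklore] -/
theorem _root_.Literature.MathematicalPhysics.QuantumLattice.SchwingerFamily.timeVec_zero : timeVec (d := d) 0 = 0 := by
  ext i; simp [timeVec]

/-- The time reflection of `t e₀` is `-t e₀`. [folklore] -/
theorem _root_.Literature.MathematicalPhysics.QuantumLattice.SchwingerFamily.timeReflection_timeVec (t : ℝ) : QuantumLattice.timeReflection d (timeVec t) = -timeVec t := by
  ext i
  rw [QuantumLattice.timeReflection_apply]
  by_cases hi : i = 0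
  · subst hi; simp [timeVec]
  · simp [timeVec, hi]

/-- **The OS adjoint of a translate is the reflected translate of the OS adjoint**:
`Θ(F_a)* = (ΘF*)_{θa}`. [folklore] -/
theorem _root_.Literature.MathematicalPhysics.QuantumLattice.SchwingerFamily.osAdjoint_translateMulti {n : ℕ} (a : EuclideanSpace ℝ (Fin d))
    (F : 𝓢((Fin n → EuclideanSpace ℝ (Fin d)), ℂ)) :
    QuantumLattice.osAdjoint (QuantumLattice.translateMulti a F) = QuantumLattice.translateMulti (QuantumLattice.timeReflection d a) (QuantumLattice.osAdjoint F) := by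
  ext x
  simp only [QuantumLattice.osAdjoint_apply, QuantumLattice.translateMulti_apply, map_sub, QuantumLattice.timeReflection_timeReflection]

/-- Translating by `t e₀`, `t ≥ 0`, preserves positive-time test functions. [folklore] -/
theorem _root_.Literature.MathematicalPhysics.QuantumLattice.SchwingerFamily.IsPositiveTimeMulti.translateMulti_timeVec {n : ℕ} {F : 𝓢((Fin n → EuclideanSpace ℝ (Fin d)), ℂ)}
    (hF : QuantumLattice.IsPositiveTimeMulti F) {t : ℝ} (ht : 0 ≤ t) : QuantumLattice.IsPositiveTimeMulti (QuantumLattice.translateMulti (timeVec t) F) := by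
  intro x hx
  have hx' : x ∈ tsupport (fun y : Fin n → EuclideanSpace ℝ (Fin d) => F (fun i => y i - timeVec t)) := by
    have : (QuantumLattice.translateMulti (timeVec t) F : (Fin n → EuclideanSpace ℝ (Fin d)) → ℂ) =
        fun y => F (fun i => y i - timeVec t) := funext fun y => QuantumLattice.translateMulti_apply _ F y
    rwa [this] at hx
  have hcont : Continuous fun y : Fin n → EuclideanSpace ℝ (Fin d) => fun i => y i - timeVec t := by
    fun_prop
  have h := hF (tsupport_comp_subset_preimage (F : (Fin n → EuclideanSpace ℝ (Fin d)) → ℂ) hcont hx')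
  intro i
  have hi := h i
  have h0 : (timeVec t : EuclideanSpace ℝ (Fin d)) 0 = t := by simp [timeVec]
  have : (x i - timeVec t : EuclideanSpace ℝ (Fin d)) 0 = x i 0 - t := by rw [PiLp.sub_apply, h0]
  change 0 < (x i - timeVec t : EuclideanSpace ℝ (Fin d)) 0 at hi
  rw [this] at hi
  change 0 < x i 0
  linarith

/-- **Time translation of generators** by `t` (the identity for `t < 0`). [folklore] -/
def _root_.Literature.MathematicalPhysics.QuantumLattice.SchwingerFamily.shiftGen (t : ℝ) (p : PosGen d) : PosGen d :=
  if ht : 0 ≤ t then ⟨p.1, ⟨QuantumLattice.translateMulti (timeVec t) p.2.1, IsPositiveTimeMulti.translateMulti_timeVec p.2.2 ht⟩⟩ else p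

/-- `shiftGen` for `t ≥ 0`. [folklore] -/
theorem _root_.Literature.MathematicalPhysics.QuantumLattice.SchwingerFamily.shiftGen_of_nonneg {t : ℝ} (ht : 0 ≤ t) (p : PosGen d) :
    shiftGen t p = ⟨p.1, ⟨QuantumLattice.translateMulti (timeVec t) p.2.1, IsPositiveTimeMulti.translateMulti_timeVec p.2.2 ht⟩⟩ :=
  dif_pos ht

/-- `shiftGen t = id` for `t < 0` (junk convention). [folklore] -/
theorem _root_.Literature.MathematicalPhysics.QuantumLattice.SchwingerFamily.shiftGen_of_neg {t : ℝ} (ht : t < 0) (p : PosGen d) : shiftGen t p = p := dif_neg (not_le.2 ht)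

/-- `shiftGen 0 = id`. [folklore] -/
theorem _root_.Literature.MathematicalPhysics.QuantumLattice.SchwingerFamily.shiftGen_zero (p : PosGen d) : shiftGen 0 p = p := by
  rw [shiftGen_of_nonneg le_rfl]
  rcases p with ⟨n, F, hF⟩
  exact Sigma.ext rfl (heq_of_eq (Subtype.ext (by simp [timeVec_zero, QuantumLattice.translateMulti_zero])))

/-- `shiftGen (s + t) = shiftGen s ∘ shiftGen t` for `s, t ≥ 0`. [folklore] -/
theorem _root_.Literature.MathematicalPhysics.QuantumLattice.SchwingerFamily.shiftGen_add {s t : ℝ} (hs : 0 ≤ s) (ht : 0 ≤ t) (p : PosGen d) :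
    shiftGen (s + t) p = shiftGen s (shiftGen t p) := by
  rw [shiftGen_of_nonneg (add_nonneg hs ht), shiftGen_of_nonneg ht, shiftGen_of_nonneg hs]
  exact Sigma.ext rfl (heq_of_eq (Subtype.ext (by simp [timeVec_add, QuantumLattice.translateMulti_translateMulti])))

/-- **Symmetry of time translation on generators** (Osterwalder–Schrader I (1973), (4.7); E1):
`𝔖(Θ(F_t)* ⊗ G) = 𝔖(ΘF* ⊗ G_t)` — `Θ(F_t)* = (ΘF*)_{-t}` and joint translation invariance. [cite: OsterwalderSchraderCMP1973, §4.1 eq. (4.7)] -/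
theorem _root_.Literature.MathematicalPhysics.QuantumLattice.SchwingerFamily.genPairing_shiftGen_left (hE1 : 𝔖.IsEuclideanCovariant) {t : ℝ} (ht : 0 ≤ t) (p q : PosGen d) :
    genPairing 𝔖 (shiftGen t p) q = genPairing 𝔖 p (shiftGen t q) := by
  rw [shiftGen_of_nonneg ht, shiftGen_of_nonneg ht]
  change 𝔖 (p.1 + q.1) (SchwartzMap.appendTensor (QuantumLattice.osAdjoint (QuantumLattice.translateMulti (timeVec t) p.2.1)) q.2.1) =
    𝔖 (p.1 + q.1) (SchwartzMap.appendTensor (QuantumLattice.osAdjoint p.2.1) (QuantumLattice.translateMulti (timeVec t) q.2.1))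
  rw [osAdjoint_translateMulti, timeReflection_timeVec]
  have h := hE1.translateMulti (p.1 + q.1) (timeVec t)
    (SchwartzMap.appendTensor (QuantumLattice.translateMulti (-timeVec t) (QuantumLattice.osAdjoint p.2.1)) q.2.1)
  rw [← h, QuantumLattice.translateMulti_appendTensor, QuantumLattice.translateMulti_translateMulti, add_neg_cancel, QuantumLattice.translateMulti_zero]

section OSSpace
open Literature.MathematicalPhysics.QuantumLattice.SchwingerFamily (OSSpace)
open Literature.MathematicalPhysics.QuantumLattice.SchwingerFamily.OSSpace

variable {𝔖} {hE2 : 𝔖.IsOSReflectionPositive}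

/-- The OS form after relabelling the generators (`Finsupp.mapDomain`). [folklore] -/
theorem _root_.Literature.MathematicalPhysics.QuantumLattice.SchwingerFamily.OSSpace.osFormFree_mapDomain (φ ψ : PosGen d → PosGen d) (v w : PosGen d →₀ ℂ) :
    osFormFree 𝔖 (Finsupp.mapDomain φ v) (Finsupp.mapDomain ψ w) =
      ∑ p ∈ v.support, ∑ q ∈ w.support, conj (v p) * w q * genPairing 𝔖 (φ p) (ψ q) := by
  simp only [osFormFree]
  rw [Finsupp.linearCombination_mapDomain, Finsupp.linearCombination_apply, Finsupp.sum, map_sum]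
  refine Finset.sum_congr rfl fun p _ => ?_
  simp only [Function.comp_apply, smul_eq_mul, map_mul, Complex.conj_conj]
  rw [Finsupp.linearCombination_mapDomain, Finsupp.linearCombination_apply, Finsupp.sum, Finset.mul_sum]
  refine Finset.sum_congr rfl fun q _ => ?_
  simp only [Function.comp_apply, smul_eq_mul]
  ring

variable (𝔖 hE2) in
/-- **The time-translation operator `T(t)` on the pre-Hilbert space**, generatorwise
(Osterwalder–Schrader I (1973), (4.6)). [cite: OsterwalderSchraderCMP1973, §4.1 eq. (4.6)] -/
def _root_.Literature.MathematicalPhysics.QuantumLattice.SchwingerFamily.OSSpace.shiftOp (t : ℝ) : OSSpace 𝔖 hE2 →ₗ[ℂ] OSSpace 𝔖 hE2 :=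
  (of 𝔖 hE2).toLinearMap ∘ₗ Finsupp.lmapDomain ℂ ℂ (shiftGen t) ∘ₗ (of 𝔖 hE2).symm.toLinearMap

/-- `T(t)` relabels the generators. [folklore] -/
theorem _root_.Literature.MathematicalPhysics.QuantumLattice.SchwingerFamily.OSSpace.shiftOp_of (t : ℝ) (v : PosGen d →₀ ℂ) :
    shiftOp 𝔖 hE2 t (of 𝔖 hE2 v) = of 𝔖 hE2 (Finsupp.mapDomain (shiftGen t) v) := by
  simp only [shiftOp, LinearMap.comp_apply, LinearEquiv.coe_toLinearMap, LinearEquiv.symm_apply_apply,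
    Finsupp.lmapDomain_apply]

/-- `T(0) = 1`. [folklore] -/
theorem _root_.Literature.MathematicalPhysics.QuantumLattice.SchwingerFamily.OSSpace.shiftOp_zero : shiftOp 𝔖 hE2 0 = LinearMap.id := by
  refine LinearMap.ext fun v => ?_
  rw [← of_symm_eq v, shiftOp_of, LinearMap.id_apply]
  congr 1
  have : (shiftGen 0 : PosGen d → PosGen d) = id := funext shiftGen_zero
  rw [this, Finsupp.mapDomain_id]

/-- `T(t) = 1` for `t < 0` (junk convention). [folklore] -/
theorem _root_.Literature.MathematicalPhysics.QuantumLattice.SchwingerFamily.OSSpace.shiftOp_of_neg {t : ℝ} (ht : t < 0) : shiftOp 𝔖 hE2 t = LinearMap.id := by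
  refine LinearMap.ext fun v => ?_
  rw [← of_symm_eq v, shiftOp_of, LinearMap.id_apply]
  congr 1
  have : (shiftGen t : PosGen d → PosGen d) = id := funext (shiftGen_of_neg ht)
  rw [this, Finsupp.mapDomain_id]

/-- **Semigroup law** `T(s + t) = T(s) T(t)` for `s, t ≥ 0`. [folklore] -/
theorem _root_.Literature.MathematicalPhysics.QuantumLattice.SchwingerFamily.OSSpace.shiftOp_add {s t : ℝ} (hs : 0 ≤ s) (ht : 0 ≤ t) :
    shiftOp 𝔖 hE2 (s + t) = shiftOp 𝔖 hE2 s ∘ₗ shiftOp 𝔖 hE2 t := by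
  refine LinearMap.ext fun v => ?_
  rw [← of_symm_eq v]
  simp only [LinearMap.comp_apply, shiftOp_of, ← Finsupp.mapDomain_comp]
  congr 2
  funext p
  exact shiftGen_add hs ht p

/-- **`T(t)` is symmetric**: `⟪T(t) v, w⟫ = ⟪v, T(t) w⟫` for `t ≥ 0` (E1). [cite: OsterwalderSchraderCMP1973, §4.1 eq. (4.7)] -/
theorem _root_.Literature.MathematicalPhysics.QuantumLattice.SchwingerFamily.OSSpace.inner_shiftOp_left (hE1 : 𝔖.IsEuclideanCovariant) {t : ℝ} (ht : 0 ≤ t) (v w : OSSpace 𝔖 hE2) :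
    ⟪shiftOp 𝔖 hE2 t v, w⟫_ℂ = ⟪v, shiftOp 𝔖 hE2 t w⟫_ℂ := by
  rw [← of_symm_eq v, ← of_symm_eq w]
  set v' := (of 𝔖 hE2).symm v
  set w' := (of 𝔖 hE2).symm w
  rw [shiftOp_of, shiftOp_of, inner_def, inner_def]
  simp only [LinearEquiv.symm_apply_apply]
  rw [← (Finsupp.mapDomain_id : Finsupp.mapDomain id w' = w'), osFormFree_mapDomain, Finsupp.mapDomain_id,
    ← (Finsupp.mapDomain_id : Finsupp.mapDomain id v' = v'), osFormFree_mapDomain, Finsupp.mapDomain_id]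
  refine Finset.sum_congr rfl fun p _ => Finset.sum_congr rfl fun q _ => ?_
  rw [id, id, genPairing_shiftGen_left 𝔖 hE1 ht]

/-- `T(t)` fixes the vacuum generator. [folklore] -/
theorem _root_.Literature.MathematicalPhysics.QuantumLattice.SchwingerFamily.OSSpace.shiftGen_vacGen (t : ℝ) : shiftGen t (vacGen d) = vacGen d := by
  by_cases ht : 0 ≤ t
  · rw [shiftGen_of_nonneg ht]
    refine Sigma.ext rfl (heq_of_eq (Subtype.ext ?_))
    ext x
    simp only [vacGen]
    erw [QuantumLattice.translateMulti_apply, SchwartzMap.constOfSubsingleton_apply (D := Fin 0 → EuclideanSpace ℝ (Fin d)) (1 : ℂ)]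
  · exact dif_neg ht

/-- `T(t) δ_Ω = δ_Ω`. [folklore] -/
theorem _root_.Literature.MathematicalPhysics.QuantumLattice.SchwingerFamily.OSSpace.shiftOp_δ_vacGen (t : ℝ) : shiftOp 𝔖 hE2 t (δ 𝔖 hE2 (vacGen d)) = δ 𝔖 hE2 (vacGen d) := by
  rw [δ, shiftOp_of, Finsupp.mapDomain_single, shiftGen_vacGen]

end OSSpace

/-! ## Contraction of the time-translation semigroup (E0, E1, E2) -/

/-- **Growth version of the `n → ∞` lemma**: if `aₙ ≤ C Kⁿ` (`K ≥ 1`) and `aₙ² ≤ c aₙ₊₁`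
(`c ≥ 0`) for all `n`, then `a₀ ≤ c`. (Otherwise `aₙ ≥ c (a₀/c)^{2ⁿ}` grows doubly
exponentially; Osterwalder–Schrader I (1973), (4.8)–(4.9), where the polynomial temperedness
bound plays the role of `C Kⁿ` along `t, 2t, 4t, …`.) Strictly generalises the tree's
`Literature.MathematicalPhysics.QuantumLattice.le_of_sq_le_mul_succ` (`OSContractionSemigroup`, the case `K = 1`), which a librarian
may fold into this one. [cite: OsterwalderSchraderCMP1973, §4.1 eqs. (4.8)–(4.9)] -/
theorem le_of_sq_le_mul_succ_of_le_mul_pow {a : ℕ → ℝ} {c C K : ℝ} (hc : 0 ≤ c)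
    (hK : 1 ≤ K) (hbdd : ∀ n, a n ≤ C * K ^ n) (hsq : ∀ n, a n ^ 2 ≤ c * a (n + 1)) : a 0 ≤ c := by
  by_contra h
  push Not at h
  have ha0 : 0 < a 0 := hc.trans_lt h
  have hcpos : 0 < c := by
    rcases hc.lt_or_eq with hc' | hc'
    · exact hc'
    · exfalso
      have := hsq 0
      rw [← hc', zero_mul] at this
      nlinarith
  set r := a 0 / c with hr
  have hr1 : 1 < r := by rwa [hr, one_lt_div hcpos]
  have hclaim : ∀ n : ℕ, c * r ^ (2 ^ n) ≤ a n := by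
    intro n
    induction n with
    | zero => rw [pow_zero, pow_one, hr, mul_div_cancel₀ _ hcpos.ne']
    | succ n ih =>
      have h0 : 0 ≤ c * r ^ (2 ^ n) := by positivity
      have h1 : (c * r ^ (2 ^ n)) ^ 2 ≤ a n ^ 2 := pow_le_pow_left₀ h0 ih 2
      have h2 : (c * r ^ (2 ^ n)) ^ 2 = c * (c * r ^ (2 ^ (n + 1))) := by ring
      have h3 := (h1.trans (hsq n))
      rw [h2] at h3
      exact le_of_mul_le_mul_left h3 hcpos
  -- choose `m₀` with `s := r^{2^{m₀}} ≥ 2K`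
  obtain ⟨m₀, hm₀⟩ := pow_unbounded_of_one_lt (2 * K) hr1
  have hs : 2 * K ≤ r ^ (2 ^ m₀) := by
    refine hm₀.le.trans (pow_le_pow_right₀ hr1.le ?_)
    exact (Nat.lt_two_pow_self).le
  -- along `n = m₀ + j`: `c (2K)^{j+1} ≤ c r^{2^{m₀+j}} ≤ a (m₀ + j) ≤ C K^{m₀+j}`, whence `c 2^{j+1} ≤ C K^{m₀}`
  have hCpos : 0 < C := by
    have := (hclaim 0).trans (hbdd 0)
    simp only [pow_zero, pow_one, mul_one] at this
    nlinarith [mul_pos hcpos (zero_lt_one.trans hr1)]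
  have hKpos : 0 < K := zero_lt_one.trans_le hK
  have key : ∀ j : ℕ, c * (2 : ℝ) ^ (j + 1) ≤ C * K ^ m₀ := by
    intro j
    have h1 : r ^ (2 ^ (m₀ + j)) = (r ^ (2 ^ m₀)) ^ (2 ^ j) := by rw [← pow_mul, ← pow_add]
    have h2 : (2 * K) ^ (j + 1) ≤ (r ^ (2 ^ m₀)) ^ (2 ^ j) := by
      calc (2 * K) ^ (j + 1) ≤ (r ^ (2 ^ m₀)) ^ (j + 1) := pow_le_pow_left₀ (by positivity) hs _
        _ ≤ (r ^ (2 ^ m₀)) ^ (2 ^ j) :=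
            pow_le_pow_right₀ (one_le_pow₀ hr1.le) (Nat.succ_le_of_lt (Nat.lt_two_pow_self))
    have h3 : c * (2 * K) ^ (j + 1) ≤ C * K ^ (m₀ + j) := by
      calc c * (2 * K) ^ (j + 1) ≤ c * r ^ (2 ^ (m₀ + j)) := by
            rw [h1]; exact mul_le_mul_of_nonneg_left h2 hc
        _ ≤ a (m₀ + j) := hclaim _
        _ ≤ C * K ^ (m₀ + j) := hbdd _
    rw [mul_pow, pow_add K m₀ j] at h3
    -- `c 2^{j+1} K^{j+1} ≤ C K^{m₀} K^j`, divide by `K^j ≥ 0` and use `K ≥ 1`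
    have h4 : c * 2 ^ (j + 1) * K ^ j ≤ C * K ^ m₀ * K ^ j := by
      calc c * 2 ^ (j + 1) * K ^ j ≤ c * 2 ^ (j + 1) * K ^ (j + 1) :=
            mul_le_mul_of_nonneg_left (pow_le_pow_right₀ hK (Nat.le_succ j)) (by positivity)
        _ = c * (2 ^ (j + 1) * K ^ (j + 1)) := by ring
        _ ≤ C * (K ^ m₀ * K ^ j) := h3
        _ = C * K ^ m₀ * K ^ j := by ring
    exact le_of_mul_le_mul_right h4 (pow_pos hKpos j)
  obtain ⟨j, hj⟩ := pow_unbounded_of_one_lt (C * K ^ m₀ / c) (by norm_num : (1 : ℝ) < 2)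
  have h6 := key j
  rw [pow_succ] at h6
  rw [div_lt_iff₀ hcpos] at hj
  have h7 : (2 : ℝ) ^ j * c ≤ c * (2 ^ j * 2) := by nlinarith [pow_pos (zero_lt_two (α := ℝ)) j]
  linarith

section OSSpace
open Literature.MathematicalPhysics.QuantumLattice.SchwingerFamily (OSSpace)
open Literature.MathematicalPhysics.QuantumLattice.SchwingerFamily.OSSpace

variable {𝔖} {hE2 : 𝔖.IsOSReflectionPositive}

/-- `‖T(t) v‖² = Re ⟪v, T(2t) v⟫` for `t ≥ 0` (symmetry and the semigroup law). [folklore] -/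
theorem _root_.Literature.MathematicalPhysics.QuantumLattice.SchwingerFamily.OSSpace.norm_shiftOp_sq (hE1 : 𝔖.IsEuclideanCovariant) {t : ℝ} (ht : 0 ≤ t) (v : OSSpace 𝔖 hE2) :
    ‖shiftOp 𝔖 hE2 t v‖ ^ 2 = RCLike.re ⟪v, shiftOp 𝔖 hE2 (2 * t) v⟫_ℂ := by
  rw [← inner_self_eq_norm_sq (𝕜 := ℂ), inner_shiftOp_left hE1 ht, ← LinearMap.comp_apply,
    ← shiftOp_add ht ht, two_mul]

/-- The iteration inequality `‖T(t) v‖² ≤ ‖v‖ ‖T(2t) v‖` (Osterwalder–Schrader I (1973),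
(4.9)). [cite: OsterwalderSchraderCMP1973, §4.1 eq. (4.9)] -/
theorem _root_.Literature.MathematicalPhysics.QuantumLattice.SchwingerFamily.OSSpace.norm_shiftOp_sq_le (hE1 : 𝔖.IsEuclideanCovariant) {t : ℝ} (ht : 0 ≤ t) (v : OSSpace 𝔖 hE2) :
    ‖shiftOp 𝔖 hE2 t v‖ ^ 2 ≤ ‖v‖ * ‖shiftOp 𝔖 hE2 (2 * t) v‖ := by
  rw [norm_shiftOp_sq hE1 ht]
  exact (RCLike.re_le_norm _).trans (norm_inner_le_norm _ _)

end OSSpace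

/-! ## Temperedness of each `𝔖ₙ` (E0, automatic) -/

/-- **Discharge of the named fact `SchwingerFamily.exists_bound`** (OS 1973 §3 (E0): each `𝔖ₙ`,
being a continuous linear functional on `𝓢`, is bounded by a Schwartz norm of finite order,
`|𝔖ₙ(F)| ≤ C |F|_s`): `Seminorm.bound_of_continuous` for `schwartz_withSeminorms`, and a finite
set of seminorm indices lies below some `(s, s)`. [cite: OsterwalderSchraderCMP1973, §3 (E0)] -/
theorem _root_.Literature.MathematicalPhysics.QuantumLattice.SchwingerFamily.exists_bound_holds {E : Type*} [NormedAddCommGroup E] [NormedSpace ℝ E] :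
    SchwingerFamily.exists_bound (E := E) := by
  intro S n
  set q : Seminorm ℂ 𝓢((Fin n → E), ℂ) := (normSeminorm ℂ ℂ).comp (S n).toLinearMap with hq_def
  have hq : Continuous q := continuous_norm.comp (S n).continuous
  obtain ⟨K, C, -, hle⟩ := Seminorm.bound_of_continuous (schwartz_withSeminorms ℂ (Fin n → E) ℂ) q hq
  set s : ℕ := K.sup fun i => max i.1 i.2
  have hK : K ⊆ Finset.Iic (s, s) := fun i hi => by
    rw [Finset.mem_Iic]
    have h := Finset.le_sup (f := fun i : ℕ × ℕ => max i.1 i.2) hi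
    exact ⟨(le_max_left _ _).trans h, (le_max_right _ _).trans h⟩
  refine ⟨s, C, fun F => ?_⟩
  have h1 : q F ≤ (C • K.sup (schwartzSeminormFamily ℂ (Fin n → E) ℂ)) F := hle F
  rw [smul_apply, NNReal.smul_def, smul_eq_mul] at h1
  refine h1.trans (mul_le_mul_of_nonneg_left ?_ C.coe_nonneg)
  exact Seminorm.le_def.1 (Finset.sup_mono hK) F

/-! ### Temperedness bounds (E0) and the contraction property -/

omit [NeZero d] in
/-- Translating the second factor of a tensor product is translating the product by
`(0, …, 0, a, …, a)`. [folklore] -/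
theorem _root_.Literature.MathematicalPhysics.QuantumLattice.SchwingerFamily.appendTensor_translateMulti_eq {n m : ℕ} (A : 𝓢((Fin n → EuclideanSpace ℝ (Fin d)), ℂ))
    (B : 𝓢((Fin m → EuclideanSpace ℝ (Fin d)), ℂ)) (a : EuclideanSpace ℝ (Fin d)) :
    SchwartzMap.appendTensor A (QuantumLattice.translateMulti a B) =
      SchwartzMap.compSubConstCLM ℂ (Fin.append (fun _ : Fin n => (0 : EuclideanSpace ℝ (Fin d)))
        (fun _ : Fin m => a)) (SchwartzMap.appendTensor A B) := by
  ext x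
  simp only [SchwartzMap.appendTensor_apply, QuantumLattice.translateMulti_apply, SchwartzMap.compSubConstCLM_apply]
  congr 1
  · congr 1; funext j; simp
  · congr 1; funext j; simp

omit [NeZero d] in
/-- `‖(0, …, 0, a, …, a)‖ ≤ ‖a‖` (sup norm). [folklore] -/
theorem _root_.Literature.MathematicalPhysics.QuantumLattice.SchwingerFamily.norm_append_zero_const_le {n m : ℕ} (a : EuclideanSpace ℝ (Fin d)) :
    ‖(Fin.append (fun _ : Fin n => (0 : EuclideanSpace ℝ (Fin d))) (fun _ : Fin m => a) :
      Fin (n + m) → EuclideanSpace ℝ (Fin d))‖ ≤ ‖a‖ := by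
  rw [pi_norm_le_iff_of_nonneg (norm_nonneg _)]
  intro i
  refine Fin.addCases (fun j => ?_) (fun j => ?_) i
  · simp
  · simp

omit [NeZero d] in
/-- **Schwartz norms of a translate**: `|X(· - w)|_M ≤ 2^M (1 + ‖w‖)^M · 2 |X|_M`
(`SchwartzMap.seminorm_compSubConstCLM_le`, `SchwartzParametric`). [folklore] -/
theorem _root_.Literature.MathematicalPhysics.QuantumLattice.SchwingerFamily.schwartzNorm_compSubConstCLM_le {N : ℕ} (M : ℕ) (w : Fin N → EuclideanSpace ℝ (Fin d))
    (X : 𝓢((Fin N → EuclideanSpace ℝ (Fin d)), ℂ)) :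
    QuantumLattice.schwartzNorm M (SchwartzMap.compSubConstCLM ℂ w X) ≤ 2 ^ M * (1 + ‖w‖) ^ M * (2 * QuantumLattice.schwartzNorm M X) := by
  unfold QuantumLattice.schwartzNorm
  refine Seminorm.finset_sup_apply_le (by positivity) fun i hi => ?_
  rw [Finset.mem_Iic, Prod.le_def] at hi
  rw [SchwartzMap.schwartzSeminormFamily_apply]
  refine (SchwartzMap.seminorm_compSubConstCLM_le X i.1 i.2 w).trans ?_
  have h1 : (1 : ℝ) ≤ 1 + ‖w‖ := by linarith [norm_nonneg w]
  have hki : SchwartzMap.seminorm ℂ i.1 i.2 X ≤ ((Finset.Iic (M, M)).sup (schwartzSeminormFamily ℂ _ ℂ)) X :=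
    Seminorm.le_def.1 (Finset.le_sup (f := schwartzSeminormFamily ℂ _ ℂ)
      (Finset.mem_Iic.2 (Prod.mk_le_mk.2 ⟨hi.1, hi.2⟩))) X
  have h0i : SchwartzMap.seminorm ℂ 0 i.2 X ≤ ((Finset.Iic (M, M)).sup (schwartzSeminormFamily ℂ _ ℂ)) X :=
    Seminorm.le_def.1 (Finset.le_sup (f := schwartzSeminormFamily ℂ _ ℂ)
      (Finset.mem_Iic.2 (Prod.mk_le_mk.2 ⟨Nat.zero_le _, hi.2⟩))) X
  have hsup : 0 ≤ ((Finset.Iic (M, M)).sup (schwartzSeminormFamily ℂ _ ℂ)) X := apply_nonneg _ _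
  calc 2 ^ i.1 * (1 + ‖w‖) ^ i.1 * (SchwartzMap.seminorm ℂ i.1 i.2 X + SchwartzMap.seminorm ℂ 0 i.2 X)
      ≤ 2 ^ M * (1 + ‖w‖) ^ M * (((Finset.Iic (M, M)).sup (schwartzSeminormFamily ℂ _ ℂ)) X +
          ((Finset.Iic (M, M)).sup (schwartzSeminormFamily ℂ _ ℂ)) X) := by
        gcongr
        · norm_num
        · exact hi.1
        · exact hi.1
    _ = _ := by ring

/-- **Temperedness of translated pairings**: `|𝔖(ΘF* ⊗ G_{s})| ≤ C (1 + s)^N` for `s ≥ 0`, from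
the temperedness E0 of the single distribution `𝔖_{n+m}` (`exists_bound_holds`) and the polynomial
growth of Schwartz norms of translates (Osterwalder–Schrader I (1973), p. 92, proof of (4.8):
"`𝔖_{n+m}` is in `𝒮′` and `f` has only a finite number of nonvanishing components"). [cite: OsterwalderSchraderCMP1973, §4.1 eq. (4.8)] -/
theorem _root_.Literature.MathematicalPhysics.QuantumLattice.SchwingerFamily.exists_norm_genPairing_shiftGen_le (p q : PosGen d) :
    ∃ (C : ℝ) (N : ℕ), 0 ≤ C ∧ ∀ s : ℝ, 0 ≤ s → ‖genPairing 𝔖 p (shiftGen s q)‖ ≤ C * (1 + s) ^ N := by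
  set Np := p.1 + q.1
  obtain ⟨M, C₀, hS⟩ := exists_bound_holds 𝔖 Np
  set X := SchwartzMap.appendTensor (QuantumLattice.osAdjoint p.2.1) q.2.1
  refine ⟨|C₀| * (2 ^ M * (2 * QuantumLattice.schwartzNorm M X)), M, by
    have := QuantumLattice.schwartzNorm_nonneg M X; positivity, fun s hs => ?_⟩
  rw [shiftGen_of_nonneg hs, genPairing]
  change ‖𝔖 Np (SchwartzMap.appendTensor (QuantumLattice.osAdjoint p.2.1) (QuantumLattice.translateMulti (timeVec s) q.2.1))‖ ≤ _
  rw [appendTensor_translateMulti_eq]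
  refine (hS _).trans ?_
  have hw : ‖(Fin.append (fun _ : Fin p.1 => (0 : EuclideanSpace ℝ (Fin d))) (fun _ : Fin q.1 => timeVec s) :
      Fin (p.1 + q.1) → EuclideanSpace ℝ (Fin d))‖ ≤ s := by
    refine (norm_append_zero_const_le _).trans ?_
    rw [timeVec, PiLp.norm_single, Real.norm_of_nonneg hs]
  have h1 := schwartzNorm_compSubConstCLM_le M
    (Fin.append (fun _ : Fin p.1 => (0 : EuclideanSpace ℝ (Fin d))) (fun _ : Fin q.1 => timeVec s)) X
  have h2 : (1 + ‖(Fin.append (fun _ : Fin p.1 => (0 : EuclideanSpace ℝ (Fin d))) (fun _ : Fin q.1 => timeVec s) :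
      Fin (p.1 + q.1) → EuclideanSpace ℝ (Fin d))‖) ^ M ≤ (1 + s) ^ M :=
    pow_le_pow_left₀ (by positivity) (by linarith) M
  have hX : 0 ≤ QuantumLattice.schwartzNorm M X := QuantumLattice.schwartzNorm_nonneg M X
  calc C₀ * QuantumLattice.schwartzNorm M (SchwartzMap.compSubConstCLM ℂ _ X)
      ≤ |C₀| * QuantumLattice.schwartzNorm M (SchwartzMap.compSubConstCLM ℂ _ X) :=
        mul_le_mul_of_nonneg_right (le_abs_self C₀) (QuantumLattice.schwartzNorm_nonneg _ _)
    _ ≤ |C₀| * (2 ^ M * (1 + s) ^ M * (2 * QuantumLattice.schwartzNorm M X)) := by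
        gcongr |C₀| * ?_
        exact h1.trans (by gcongr)
    _ = |C₀| * (2 ^ M * (2 * QuantumLattice.schwartzNorm M X)) * (1 + s) ^ M := by ring

section OSSpace
open Literature.MathematicalPhysics.QuantumLattice.SchwingerFamily (OSSpace)
open Literature.MathematicalPhysics.QuantumLattice.SchwingerFamily.OSSpace

variable {𝔖} {hE2 : 𝔖.IsOSReflectionPositive}

/-- **Polynomial growth of the orbits** `‖T(s) v‖ ≤ C_v (1 + s)^{N_v}`, `s ≥ 0`, from E0 (per-`n`
temperedness) and E1 (Osterwalder–Schrader I (1973), (4.8)). [cite: OsterwalderSchraderCMP1973, §4.1 eq. (4.8)] -/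
theorem _root_.Literature.MathematicalPhysics.QuantumLattice.SchwingerFamily.OSSpace.exists_norm_shiftOp_le (hE1 : 𝔖.IsEuclideanCovariant) (v : OSSpace 𝔖 hE2) : ∃ (C : ℝ) (N : ℕ), 0 ≤ C ∧ ∀ s : ℝ, 0 ≤ s → ‖shiftOp 𝔖 hE2 s v‖ ≤ C * (1 + s) ^ N := by
  classical
  rw [← of_symm_eq v]
  generalize (of 𝔖 hE2).symm v = u
  choose Cpq Npq hCpq hpq using fun p q : PosGen d => exists_norm_genPairing_shiftGen_le 𝔖 p q
  set N : ℕ := (u.support ×ˢ u.support).sup fun pq => Npq pq.1 pq.2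
  set Ctot : ℝ := ∑ p ∈ u.support, ∑ q ∈ u.support, ‖u p‖ * ‖u q‖ * Cpq p q
  have hCtot : 0 ≤ Ctot := Finset.sum_nonneg fun p _ => Finset.sum_nonneg fun q _ =>
    mul_nonneg (mul_nonneg (norm_nonneg _) (norm_nonneg _)) (hCpq p q)
  have hinner : ∀ s : ℝ, 0 ≤ s → ‖⟪of 𝔖 hE2 u, shiftOp 𝔖 hE2 s (of 𝔖 hE2 u)⟫_ℂ‖ ≤ Ctot * (1 + s) ^ N := by
    intro s hs
    rw [shiftOp_of, inner_def]
    simp only [LinearEquiv.symm_apply_apply]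
    rw [← (Finsupp.mapDomain_id : Finsupp.mapDomain id u = u), osFormFree_mapDomain, Finsupp.mapDomain_id]
    refine (norm_sum_le _ _).trans ?_
    rw [Finset.sum_mul]
    refine Finset.sum_le_sum fun p hp => (norm_sum_le _ _).trans ?_
    rw [Finset.sum_mul]
    refine Finset.sum_le_sum fun q hq => ?_
    rw [norm_mul, norm_mul, RCLike.norm_conj, id]
    have h1va : (1 : ℝ) ≤ 1 + s := by linarith
    calc ‖u p‖ * ‖u q‖ * ‖genPairing 𝔖 p (shiftGen s q)‖ ≤ ‖u p‖ * ‖u q‖ * (Cpq p q * (1 + s) ^ Npq p q) := by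
          gcongr; exact hpq p q s hs
      _ ≤ ‖u p‖ * ‖u q‖ * (Cpq p q * (1 + s) ^ N) := by
          have hN : Npq p q ≤ N := Finset.le_sup (f := fun pq : PosGen d × PosGen d => Npq pq.1 pq.2)
            (Finset.mk_mem_product hp hq)
          exact mul_le_mul_of_nonneg_left (mul_le_mul_of_nonneg_left (pow_le_pow_right₀ h1va hN) (hCpq p q))
            (by positivity)
      _ = ‖u p‖ * ‖u q‖ * Cpq p q * (1 + s) ^ N := by ring
  refine ⟨1 + Ctot * 2 ^ N, N, by positivity, fun s hs => ?_⟩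
  have hsq := norm_shiftOp_sq (hE2 := hE2) hE1 hs (of 𝔖 hE2 u)
  have h2 : ‖shiftOp 𝔖 hE2 s (of 𝔖 hE2 u)‖ ^ 2 ≤ Ctot * 2 ^ N * (1 + s) ^ N := by
    rw [hsq]
    refine (RCLike.re_le_norm _).trans ((hinner (2 * s) (by linarith)).trans ?_)
    have : (1 + 2 * s) ^ N ≤ (2 * (1 + s)) ^ N := pow_le_pow_left₀ (by linarith) (by linarith) N
    rw [mul_pow] at this
    calc Ctot * (1 + 2 * s) ^ N ≤ Ctot * (2 ^ N * (1 + s) ^ N) := mul_le_mul_of_nonneg_left this hCtot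
      _ = Ctot * 2 ^ N * (1 + s) ^ N := by ring
  have hx : ‖shiftOp 𝔖 hE2 s (of 𝔖 hE2 u)‖ ≤ 1 + ‖shiftOp 𝔖 hE2 s (of 𝔖 hE2 u)‖ ^ 2 := by
    nlinarith [norm_nonneg (shiftOp 𝔖 hE2 s (of 𝔖 hE2 u))]
  have h1s : (1 : ℝ) ≤ (1 + s) ^ N := one_le_pow₀ (by linarith)
  calc ‖shiftOp 𝔖 hE2 s (of 𝔖 hE2 u)‖ ≤ 1 + Ctot * 2 ^ N * (1 + s) ^ N := hx.trans (by linarith)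
    _ ≤ (1 + Ctot * 2 ^ N) * (1 + s) ^ N := by
        nlinarith [mul_nonneg hCtot (pow_nonneg (zero_le_two (α := ℝ)) N)]

/-- **Contraction property of the time-translation semigroup** (Osterwalder–Schrader I (1973),
(4.8)–(4.9): "By (E0) and (E1) there exists a one parameter semigroup of self-adjoint
contractions"; Glimm–Jaffe Thm. 6.1.3 (iii)): `‖T(t) v‖ ≤ ‖v‖` for `t ≥ 0`, from E1 (symmetry),
E2 (the inner product) and E0 (polynomial growth of the orbits), by the doubly exponential
iteration of `‖T(t) v‖² ≤ ‖v‖ ‖T(2t) v‖`. [cite: OsterwalderSchraderCMP1973, §4.1 eqs. (4.8)–(4.9)] -/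
theorem _root_.Literature.MathematicalPhysics.QuantumLattice.SchwingerFamily.OSSpace.norm_shiftOp_le_of_nonneg (hE1 : 𝔖.IsEuclideanCovariant) {t : ℝ}
    (ht : 0 ≤ t) (v : OSSpace 𝔖 hE2) : ‖shiftOp 𝔖 hE2 t v‖ ≤ ‖v‖ := by
  obtain ⟨C, N, hC, hbound⟩ := exists_norm_shiftOp_le hE1 v
  set a : ℕ → ℝ := fun n => ‖shiftOp 𝔖 hE2 (2 ^ n * t) v‖
  have hsq : ∀ n, a n ^ 2 ≤ ‖v‖ * a (n + 1) := fun n => by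
    have := norm_shiftOp_sq_le (hE2 := hE2) hE1 (t := 2 ^ n * t) (by positivity) v
    simpa [a, pow_succ, mul_comm, mul_assoc, mul_left_comm] using this
  have hbdd : ∀ n, a n ≤ C * (1 + t) ^ N * ((2 : ℝ) ^ N) ^ n := fun n => by
    refine (hbound (2 ^ n * t) (by positivity)).trans ?_
    have h1 : (1 + 2 ^ n * t) ^ N ≤ (2 ^ n * (1 + t)) ^ N := by
      refine pow_le_pow_left₀ (by positivity) ?_ N
      have : (1 : ℝ) ≤ 2 ^ n := one_le_pow₀ (by norm_num)
      nlinarith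
    calc C * (1 + 2 ^ n * t) ^ N ≤ C * (2 ^ n * (1 + t)) ^ N := mul_le_mul_of_nonneg_left h1 hC
      _ = C * (1 + t) ^ N * ((2 : ℝ) ^ N) ^ n := by rw [mul_pow, ← pow_mul, ← pow_mul, mul_comm n N]; ring
  have hK : (1 : ℝ) ≤ (2 : ℝ) ^ N := one_le_pow₀ (by norm_num)
  have := le_of_sq_le_mul_succ_of_le_mul_pow (norm_nonneg v) hK hbdd hsq
  simpa [a] using this

/-- `‖T(t) v‖ ≤ ‖v‖` for all `t` (the identity for `t < 0`). [folklore] -/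
theorem _root_.Literature.MathematicalPhysics.QuantumLattice.SchwingerFamily.OSSpace.norm_shiftOp_le (hE1 : 𝔖.IsEuclideanCovariant) (t : ℝ) (v : OSSpace 𝔖 hE2) :
    ‖shiftOp 𝔖 hE2 t v‖ ≤ ‖v‖ := by
  rcases le_or_gt 0 t with ht | ht
  · exact norm_shiftOp_le_of_nonneg hE1 ht v
  · rw [shiftOp_of_neg ht, LinearMap.id_apply]

/-! ### The contraction semigroup on the Hilbert space -/

variable (hE2) in
/-- **The time-translation operator `e^{-tH}` on the OS Hilbert space**: the extension by
continuity (`LinearMap.extendOfNorm`) of `T(t)` from the dense pre-Hilbert space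
(Osterwalder–Schrader I (1973), p. 92, text after (4.9): "`T^t` … has a self-adjoint extension to
`ℋ` which we denote by the same symbol"; Glimm–Jaffe Thm. 6.1.3). Same junk convention as
`shiftGen`/`shiftOp`: the identity for `t < 0`. [cite: OsterwalderSchraderCMP1973, §4.1, text after (4.9), p. 92] -/
def _root_.Literature.MathematicalPhysics.QuantumLattice.SchwingerFamily.OSSpace.shiftH (t : ℝ) : OSHilbert 𝔖 hE2 →L[ℂ] OSHilbert 𝔖 hE2 :=
  ((ι 𝔖 hE2).toLinearMap ∘ₗ shiftOp 𝔖 hE2 t).extendOfNorm (ι 𝔖 hE2).toLinearMap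

/-- `e^{-tH} [v] = [T(t) v]`. [folklore] -/
theorem _root_.Literature.MathematicalPhysics.QuantumLattice.SchwingerFamily.OSSpace.shiftH_ι (hE1 : 𝔖.IsEuclideanCovariant) (t : ℝ) (v : OSSpace 𝔖 hE2) :
    shiftH hE2 t (ι 𝔖 hE2 v) = ι 𝔖 hE2 (shiftOp 𝔖 hE2 t v) :=
  LinearMap.extendOfNorm_eq denseRange_ι ⟨1, fun x => by
    simpa using norm_shiftOp_le (hE2 := hE2) hE1 t x⟩ v

/-- **`e^{-tH}` is a contraction**: `‖e^{-tH} ψ‖ ≤ ‖ψ‖` (Osterwalder–Schrader I (1973), (4.9)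
and the text after it, p. 92; for `t < 0` the operator is the identity by the junk
convention). [cite: OsterwalderSchraderCMP1973, §4.1 eq. (4.9)] -/
theorem _root_.Literature.MathematicalPhysics.QuantumLattice.SchwingerFamily.OSSpace.norm_shiftH_le (hE1 : 𝔖.IsEuclideanCovariant) (t : ℝ)
    (ψ : OSHilbert 𝔖 hE2) : ‖shiftH hE2 t ψ‖ ≤ ‖ψ‖ := by
  have h : ‖shiftH hE2 t ψ‖ ≤ 1 * ‖ψ‖ :=
    LinearMap.norm_extendOfNorm_apply_le denseRange_ι 1 (fun x => by
      simpa using norm_shiftOp_le (hE2 := hE2) hE1 t x) ψ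
  simpa using h

/-- `e^{-0H} = 1`. [folklore] -/
theorem _root_.Literature.MathematicalPhysics.QuantumLattice.SchwingerFamily.OSSpace.shiftH_zero_apply (hE1 : 𝔖.IsEuclideanCovariant) (ψ : OSHilbert 𝔖 hE2) :
    shiftH hE2 0 ψ = ψ := by
  refine denseRange_ι.induction_on ψ (isClosed_eq (shiftH hE2 0).continuous continuous_id) fun v => ?_
  rw [shiftH_ι hE1 0, shiftOp_zero, LinearMap.id_apply]

/-- **Semigroup law** `e^{-(s+t)H} = e^{-sH} e^{-tH}` for `s, t ≥ 0`. [folklore] -/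
theorem _root_.Literature.MathematicalPhysics.QuantumLattice.SchwingerFamily.OSSpace.shiftH_add_apply (hE1 : 𝔖.IsEuclideanCovariant) {s t : ℝ}
    (hs : 0 ≤ s) (ht : 0 ≤ t) (ψ : OSHilbert 𝔖 hE2) :
    shiftH hE2 (s + t) ψ = shiftH hE2 s (shiftH hE2 t ψ) := by
  refine denseRange_ι.induction_on ψ ?_ fun v => ?_
  · exact isClosed_eq (shiftH hE2 (s + t)).continuous
      ((shiftH hE2 s).continuous.comp (shiftH hE2 t).continuous)
  · rw [shiftH_ι hE1 (s + t), shiftH_ι hE1 t, shiftH_ι hE1 s, shiftOp_add hs ht,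
      LinearMap.comp_apply]

/-- **`e^{-tH}` is symmetric**: `⟪e^{-tH} φ, ψ⟫ = ⟪φ, e^{-tH} ψ⟫`. [cite: OsterwalderSchraderCMP1973, §4.1 eq. (4.7)] -/
theorem _root_.Literature.MathematicalPhysics.QuantumLattice.SchwingerFamily.OSSpace.inner_shiftH_left (hE1 : 𝔖.IsEuclideanCovariant) {t : ℝ} (ht : 0 ≤ t)
    (φ ψ : OSHilbert 𝔖 hE2) : ⟪shiftH hE2 t φ, ψ⟫_ℂ = ⟪φ, shiftH hE2 t ψ⟫_ℂ := by
  refine denseRange_ι.induction_on φ ?_ fun u => ?_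
  · exact isClosed_eq ((shiftH hE2 t).continuous.inner continuous_const)
      (continuous_id.inner continuous_const)
  · refine denseRange_ι.induction_on ψ ?_ fun v => ?_
    · exact isClosed_eq (continuous_const.inner continuous_id)
        (continuous_const.inner (shiftH hE2 t).continuous)
    · rw [shiftH_ι hE1 t, shiftH_ι hE1 t, inner_ι_ι, inner_ι_ι, inner_shiftOp_left hE1 ht]

/-- **`e^{-tH} Ω = Ω`**. [folklore] -/
theorem _root_.Literature.MathematicalPhysics.QuantumLattice.SchwingerFamily.OSSpace.shiftH_vacuum (hE1 : 𝔖.IsEuclideanCovariant) (t : ℝ) :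
    shiftH hE2 t (vacuum 𝔖 hE2) = vacuum 𝔖 hE2 := by
  rw [vacuum, shiftH_ι hE1 t, shiftOp_δ_vacGen]

end OSSpace

end SchwingerFamily

end Literature.MathematicalPhysics.QuantumFieldTheory
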